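import Summits.CriticalPhenomena.PercolationContinuityZ3.Theorems.PercNearOneGluingNoHeavyLowerTailAntitheticCycle
import Summits.CriticalPhenomena.PercolationContinuityZ3.Theorems.PercNearOneGluingNoHeavyLowerTailAntitheticBlockBasics
import Summits.CriticalPhenomena.PercolationContinuityZ3.Theorems.PercNearOneGluingNoHeavyLowerTailAntitheticPeel
import HarnessLib

/-!
# `NoHeavyLowerTail` (stmt-CriticalPhenomena-4575) — antithetic cluster pairs: THEOREM C WITH SINKS — `T_E(R,X) ≥ 0` on every cycle, hence the
# antithetic BHK inequality with sinks on cycles (file C5; prim-hp-2 gen 40, HOME/THEOREM-C-cycles.md)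

Support file (`--supports stmt-CriticalPhenomena-4575`, hull-port prover `prim-hp-2`, gen 40).  No definitions, no named facts, no sorries; standard
axioms.

By the peeling meta-theorem `Antithetic.Peel.tsum_nonneg_of_bic` it suffices that `BIC_{E'}(R) ≥ 0` for every edge subset `E'` of the cycle and every
`R ∌ s`.  `E' = E` is THEOREM C (`Cyc.cycle_good`); a PROPER subset misses some pair `edge v k` and is then a sub-forest of the Hamiltonian path
`v (k+1), …, v (n−1), v 0 = s, v 1, …, v k`, which is built from the empty edge set by attaching pendant pairs outward from `s` — first `edge v 0, …,
edge v (k−1)` (new leaf `v (i+1)`), then `edge v (n−1), edge v (n−2), …, edge v (k+1)` (new leaf `v i`) — skipping the pairs not in `E'`; each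
attachment preserves goodness by the pendant-edge lemma `Pendant.good_insert`.
* `Cyc.arc_good` — every `E' ⊆ E` missing a pair of the cycle is good for every `R` (no sinks);
* `Cyc.subset_good` — every `E' ⊆ E` is good for every `R`;
* `Cyc.cycle_tsum_nonneg` — `0 ≤ T_E(R,X)` on the cycle for every `R` and every sink set `X`;
* `Antithetic.cycle_sc_nonneg` — the antithetic BHK inequality with sinks `SC(E,X) = T_E(∅,X) ≥ 0` on every cycle, written out.
[cite: VandenbergHaggstromKahn2005, §1 p. 6 ("Harris' inequality"), §1 p. 3 (open cluster `C_s`)]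
-/

noncomputable section

namespace Summit.CriticalPhenomena.PercolationContinuityZ3.Theorems

open Literature.Probability.Percolation
open scoped Classical symmDiff

namespace Antithetic

namespace Cyc

variable {V : Type*} [Fintype V] {n : ℕ} {v : ℕ → V} (hn : 3 ≤ n) (hinj : ∀ i j, i < n → j < n → v i = v j → i = j) (hper : v n = v 0)
include hn hinj hper

/-- **Phase A of the pendant chain**: the pairs `edge v i ∈ E'` with `i < m ≤ k < n` form a good edge set for every `R`. -/
theorem arcA_good (E' : Set (Sym2 V)) {k : ℕ} (hk : k < n) (R : Set V) :
    ∀ m, m ≤ k → ∀ F G : Set (Sym2 V) → ℝ, Monotone F → Monotone G →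
      0 ≤ Peel.tsum F G (E' ∩ {e | ∃ i, i < m ∧ e = edge v i}) (v 0) R ∅ := by
  intro m
  induction m with
  | zero =>
    intro _
    refine Pendant.good_of_no_pairs _ (fun e he => ?_) (v 0) R ∅
    obtain ⟨i, hi, -⟩ := he.2
    exact absurd hi (Nat.not_lt_zero i)
  | succ m ih =>
    intro hm
    have ih' := ih (by omega)
    by_cases hmem : edge v m ∈ E'
    · -- attach the pendant pair `v m v (m+1)` at the new leaf `v (m+1)`
      have hset : E' ∩ {e | ∃ i, i < m + 1 ∧ e = edge v i} = insert s(v m, v (m + 1)) (E' ∩ {e | ∃ i, i < m ∧ e = edge v i}) := by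
        ext e
        simp only [Set.mem_inter_iff, Set.mem_setOf_eq, Set.mem_insert_iff]
        constructor
        · rintro ⟨he, i, hi, rfl⟩
          by_cases him : i = m
          · subst him; exact Or.inl rfl
          · exact Or.inr ⟨he, i, by omega, rfl⟩
        · rintro (rfl | ⟨he, i, hi, rfl⟩)
          · exact ⟨hmem, m, by omega, rfl⟩
          · exact ⟨he, i, by omega, rfl⟩
      rw [hset]
      intro F G hF hG
      refine Pendant.good_insert (fun f hf hℓ => ?_) (v_ne_succ hn hinj hper (i := m) (by omega)) (fun h => ?_) R ∅ (Set.notMem_empty _)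
        ih' hF hG
      · obtain ⟨i, hi, rfl⟩ := hf.2
        unfold edge at hℓ
        rcases Sym2.mem_iff.1 hℓ with h | h
        · have := hinj _ _ (by omega) (by omega) h; omega
        · have := hinj _ _ (by omega) (by omega) h; omega
      · have := hinj _ _ (by omega) (by omega) h; omega
    · have hset : E' ∩ {e | ∃ i, i < m + 1 ∧ e = edge v i} = E' ∩ {e | ∃ i, i < m ∧ e = edge v i} := by
        ext e
        simp only [Set.mem_inter_iff, Set.mem_setOf_eq]
        constructor
        · rintro ⟨he, i, hi, rfl⟩
          by_cases him : i = m
          · subst him; exact absurd he hmem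
          · exact ⟨he, i, by omega, rfl⟩
        · rintro ⟨he, i, hi, rfl⟩
          exact ⟨he, i, by omega, rfl⟩
      rw [hset]
      exact ih'

/-- **Phase B of the pendant chain**: add the pairs `edge v (n−1), …, edge v (n−t)` (those in `E'`), `n − t > k`. -/
theorem arcB_good (E' : Set (Sym2 V)) {k : ℕ} (hk : k < n) (R : Set V) :
    ∀ t, t ≤ n - 1 - k → ∀ F G : Set (Sym2 V) → ℝ, Monotone F → Monotone G →
      0 ≤ Peel.tsum F G (E' ∩ {e | ∃ i, i < n ∧ e = edge v i ∧ (i < k ∨ n - t ≤ i)}) (v 0) R ∅ := by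
  intro t
  induction t with
  | zero =>
    intro _
    have hset : E' ∩ {e | ∃ i, i < n ∧ e = edge v i ∧ (i < k ∨ n - 0 ≤ i)} = E' ∩ {e | ∃ i, i < k ∧ e = edge v i} := by
      ext e
      simp only [Set.mem_inter_iff, Set.mem_setOf_eq, Nat.sub_zero]
      constructor
      · rintro ⟨he, i, hi, rfl, h⟩
        exact ⟨he, i, by omega, rfl⟩
      · rintro ⟨he, i, hi, rfl⟩
        exact ⟨he, i, by omega, rfl, Or.inl hi⟩
    rw [hset]
    exact arcA_good hn hinj hper E' hk R k le_rfl
  | succ t ih =>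
    intro ht
    have ih' := ih (by omega)
    -- the new index
    set i₀ := n - 1 - t with hi₀
    have hi₀k : k < i₀ := by omega
    have hi₀n : i₀ < n := by omega
    by_cases hmem : edge v i₀ ∈ E'
    · have hset : E' ∩ {e | ∃ i, i < n ∧ e = edge v i ∧ (i < k ∨ n - (t + 1) ≤ i)} =
          insert s(v (i₀ + 1), v i₀) (E' ∩ {e | ∃ i, i < n ∧ e = edge v i ∧ (i < k ∨ n - t ≤ i)}) := by
        ext e
        simp only [Set.mem_inter_iff, Set.mem_setOf_eq, Set.mem_insert_iff]
        constructor
        · rintro ⟨he, i, hi, rfl, h⟩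
          by_cases hii : i = i₀
          · subst hii; left; unfold edge; rw [Sym2.eq_swap]
          · exact Or.inr ⟨he, i, hi, rfl, by omega⟩
        · rintro (rfl | ⟨he, i, hi, rfl, h⟩)
          · refine ⟨?_, i₀, hi₀n, ?_, by omega⟩
            · rw [Sym2.eq_swap]; exact hmem
            · unfold edge; rw [Sym2.eq_swap]
          · exact ⟨he, i, hi, rfl, by omega⟩
      rw [hset]
      intro F G hF hG
      refine Pendant.good_insert (fun f hf hℓ => ?_) (fun h => ?_) (fun h => ?_) R ∅ (Set.notMem_empty _) ih' hF hG
      · obtain ⟨i, hi, rfl, hik⟩ := hf.2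
        unfold edge at hℓ
        rcases Sym2.mem_iff.1 hℓ with h | h
        · have := hinj _ _ hi₀n hi h; omega
        · by_cases hi1 : i + 1 < n
          · have := hinj _ _ hi₀n hi1 h; omega
          · rw [show i + 1 = n by omega, hper] at h
            have := hinj _ _ hi₀n (by omega) h; omega
      · -- u = v (i₀+1) ≠ ℓ = v i₀
        exact v_ne_succ hn hinj hper hi₀n h.symm
      · have := hinj _ _ (by omega) hi₀n h; omega
    · have hset : E' ∩ {e | ∃ i, i < n ∧ e = edge v i ∧ (i < k ∨ n - (t + 1) ≤ i)} =
          E' ∩ {e | ∃ i, i < n ∧ e = edge v i ∧ (i < k ∨ n - t ≤ i)} := by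
        ext e
        simp only [Set.mem_inter_iff, Set.mem_setOf_eq]
        constructor
        · rintro ⟨he, i, hi, rfl, h⟩
          by_cases hii : i = i₀
          · subst hii; exact absurd he hmem
          · exact ⟨he, i, hi, rfl, by omega⟩
        · rintro ⟨he, i, hi, rfl, h⟩
          exact ⟨he, i, hi, rfl, by omega⟩
      rw [hset]
      exact ih'

/-- **Arcs are good**: an edge subset of the cycle missing some pair `edge v k` is good for every `R` (no sinks). [this work] -/
theorem arc_good (E' : Set (Sym2 V)) (hE' : E' ⊆ edgeSet n v) {k : ℕ} (hk : k < n) (hke : edge v k ∉ E') (R : Set V) :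
    ∀ F G : Set (Sym2 V) → ℝ, Monotone F → Monotone G → 0 ≤ Peel.tsum F G E' (v 0) R ∅ := by
  have h := arcB_good hn hinj hper E' hk R (n - 1 - k) le_rfl
  have hset : E' ∩ {e | ∃ i, i < n ∧ e = edge v i ∧ (i < k ∨ n - (n - 1 - k) ≤ i)} = E' := by
    ext e
    simp only [Set.mem_inter_iff, Set.mem_setOf_eq, and_iff_left_iff_imp]
    intro he
    obtain ⟨i, hi, rfl⟩ := hE' he
    refine ⟨i, hi, rfl, ?_⟩
    by_cases hik : i = k
    · subst hik; exact absurd he hke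
    · omega
  rw [hset] at h
  exact h

/-- **Every edge subset of a cycle through `s` is good for every `R`** (the hypothesis of the peeling meta-theorem). [this work] -/
theorem subset_good (E' : Set (Sym2 V)) (hE' : E' ⊆ edgeSet n v) (R : Set V) :
    ∀ F G : Set (Sym2 V) → ℝ, Monotone F → Monotone G → 0 ≤ Peel.tsum F G E' (v 0) R ∅ := by
  by_cases heq : E' = edgeSet n v
  · rw [heq]; exact cycle_good hn hinj hper R
  · have : ∃ e ∈ edgeSet n v, e ∉ E' := by
      by_contra h
      push Not at h
      exact heq (Set.Subset.antisymm hE' h)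
    obtain ⟨e, ⟨k, hk, rfl⟩, hke⟩ := this
    exact arc_good hn hinj hper E' hE' hk hke R

/-- **THEOREM C WITH SINKS**: on a cycle through `s`, `0 ≤ T_E(R,X)` for every avoidance set `R` and every sink set `X`, all increasing `F, G`. [this work] -/
theorem cycle_tsum_nonneg (R X : Set V) {F G : Set (Sym2 V) → ℝ} (hF : Monotone F) (hG : Monotone G) :
    0 ≤ Peel.tsum F G (edgeSet n v) (v 0) R X := by
  by_cases hRs : v 0 ∈ R
  · exact (Peel.tsum_eq_zero_of_mem_R F G _ (v 0) X hRs).ge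
  exact Peel.tsum_nonneg_of_bic F G (edgeSet n v) (v 0) (fun E' hE' R' _ => subset_good hn hinj hper E' hE' R' F G hF hG) R X hRs

end Cyc

section Sinks

variable {V : Type*} [Fintype V]

/-- **The antithetic BHK inequality WITH SINKS on every cycle** (prim-hp-2 gen 40): `E = {v i v (i+1) : i < n}` the edge set of a cycle
`v 0 = s, …, v (n−1), v n = v 0` (`n ≥ 3`, `v` injective on `[0,n)`), `X` any sink set, `F, G` increasing functions of the edge cluster:
`0 ≤ Σ_{ω : no x ∈ X joined to s in ω ∩ E or in ωᶜ ∩ E} (F(C_s(ω∩E)) − F(C_s(ωᶜ∩E))) · (G(C_s(ω∩E)) − G(C_s(ωᶜ∩E)))`. [this work] -/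
theorem cycle_sc_nonneg {n : ℕ} (hn : 3 ≤ n) (v : ℕ → V) (hinj : ∀ i j, i < n → j < n → v i = v j → i = j) (hper : v n = v 0)
    (X : Set V) {F G : Set (Sym2 V) → ℝ} (hF : Monotone F) (hG : Monotone G) :
    0 ≤ ∑ ω ∈ Finset.univ.filter (fun ω : Set (Sym2 V) =>
        ∀ x ∈ X, ¬ (openGraph (ω ∩ Cyc.edgeSet n v)).Reachable (v 0) x ∧ ¬ (openGraph (ωᶜ ∩ Cyc.edgeSet n v)).Reachable (v 0) x),
      (F (openEdgeCluster (ω ∩ Cyc.edgeSet n v) (v 0)) - F (openEdgeCluster (ωᶜ ∩ Cyc.edgeSet n v) (v 0))) *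
        (G (openEdgeCluster (ω ∩ Cyc.edgeSet n v) (v 0)) - G (openEdgeCluster (ωᶜ ∩ Cyc.edgeSet n v) (v 0))) := by
  have h := Cyc.cycle_tsum_nonneg hn hinj hper (∅ : Set V) X hF hG
  have hset : Peel.tset (Cyc.edgeSet n v) (v 0) ∅ X = Finset.univ.filter (fun ω : Set (Sym2 V) =>
      ∀ x ∈ X, ¬ (openGraph (ω ∩ Cyc.edgeSet n v)).Reachable (v 0) x ∧ ¬ (openGraph (ωᶜ ∩ Cyc.edgeSet n v)).Reachable (v 0) x) := by
    ext ω
    simp [Peel.mem_tset]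
  unfold Peel.tsum Peel.delta at h
  rw [hset] at h
  exact h

end Sinks

end Antithetic

end Summit.CriticalPhenomena.PercolationContinuityZ3.Theorems
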